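import Literature.MathematicalPhysics.QuantumFieldTheory.Balaban1983to89.B8Thm2LogBRec
import Literature.MathematicalPhysics.QuantumFieldTheory.Balaban1983to89.B8Eq119TwistedAxialRec
import Literature.MathematicalPhysics.QuantumFieldTheory.Balaban1983to89.B8Eq178AveragesRec
import Literature.MathematicalPhysics.QuantumFieldTheory.Balaban1983to89.B7Eq108ConcreteRec
import Literature.MathematicalPhysics.QuantumFieldTheory.Balaban1983to89.B8Eq131Derivation

/-!
# `Balaban1983to89.B8Eq131DerivationRec` — [Balaban1985RegularSpaces] Sect. B pp. 81–82: the DERIVATION «(1.29), (1.30) ⇒ (1.31)» of the averages of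
# `U₁ = U′^{u⁻¹}` from [Balaban1985Averaging] (84), (87), (92), (97), (99), (105) — FOR THE RECORD's symmetric block averaging [Balaban1987RG1] (0.4)
# (CENTRED blocks, contours from the block centres); the record twin of `B8Eq131Derivation` (LEAD PEN dag-n05-e; cell member dag-n05-d)

statement-level skeleton of published theorems with citation tags; proofs where landed; nothing here is a claim about the Yang–Mills mass gap

CITATION HEADER.  [6] = T. Bałaban, *Spaces of regular gauge field configurations on a lattice and gauge fixing conditions*, Commun. Math. Phys. **99** (1985) 75–102
[Balaban1985RegularSpaces], pp. 81–82: *«The configurations U′ satisfy the equations Ũ′ʲ = V(Ū₀ʲ)⁻¹ on Λ_j, hence U₁ satisfies (Ũ₁^{u j})_b = u(b₋)(Ũ₁ʲ)_b R̄ʲ_{0,b} u⁻¹(b₊) =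
V_b(Ū₀ʲ)_b⁻¹, b ∈ Λ_j. (1.30) … If both end-points b₋, b₊ of a bond b belong to Λ_j, then the expression on the left-hand side of (1.30) is equal to (Ū₁ʲ)_b by (92) of [3]. If a
bond b crosses the boundary of Λ_j … the formulas (97), (99), and (87) of [3] imply (Ũ₁^{u j})_b = \overline{R̄^{j−1}_{0,b₋}Ū₁^{j−1}} (Ū₁ʲ)_b = V_b(Ū₀ʲ)_b⁻¹, where by the formula
(105) of [3] \overline{R̄^{j−1}_{0,b₋}Ū₁^{j−1}} = exp[i Σ_{x∈B(b₋)} L^{−d} (1/i) log(R̄^{j−1}_{0,b₋}Ū₁^{j−1})(Γ_{b₋,x})]. … (Ū₁ʲ)_b = V′_b = exp iB_b, if b ⊂ Λ_j, (Ū₁ʲ)_b = exp[−i Σ …]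
V′_b = exp iB_b, if b₋ ∈ Λ_{j−1}, b₊ ∈ Λ_j, (1.31)»*; (1.29) p. 81, (1.17) p. 78, (1.19)–(1.20) p. 79, (1.13) p. 78.  [3] = [Balaban1985Averaging] (55), (58), (67), (69)–(71),
(78)–(80), (84)–(88), (92), (97), (99), (105).  [I] = [Balaban1987RG1] (0.3)–(0.4) pp. 252–253.
Cell `pub-ymgap`, seat `pub-ymgap-dag-n05-d` g23 — «N05-REC» road, item R4 (TOKEN RULE (T1) `avgIter ↦ avgIterZ`, `uavg ∕ wrec ∕ vcov ∕ wframe ∕ Fcov ∕ dbavgCovIter ∕ tildIter ∕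
AxialGauge ↦` dag-n05-e's `…Z` twins of `B7SectCDGaugeAveragesRec`; (T2) the block of a level-`(j+1)` site `y` is CENTRED: `L•y + offZ L r`, the box `[L•y − s𝟙, L•y + s𝟙]`
(engine: `[L•y, L•y + blockTop L]`), `Under ↦ B8Eq119TwistedAxialRec.UnderZ`; (T3) contours from the CENTRE `L•y` — with backward bonds, so the (1.19)-product is the
SIGNED one `B8Thm2LogBRec.covProdS` (= [3] (58) `tHol` on EVERY word, `covProdS_eq_tHol` below; POINT 2 of the cell bus); `InAx ↦ InAxZ` (transporter form), `Restr129 ↦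
Restr129Z`, `crossSum ∕ crossMid ∕ Bcross ∕ BcrossMirror ↦ B8Thm2LogBRec.…Z`; (T5) engine names kept).  REUSED verbatim (class 0, structure-free): `mgauge ∕ tHol ∕ R0fun ∕
eq72_iff_eq76 ∕ uLev ∕ Bint ∕ exp_I_smul_Bint ∕ B8Eq131Derivation.eq117_eq_mgauge ∕ mgauge_inv_mgauge`; dag-n05-e's record [3] layer `eq92Z ∕ wrecZ_eq_vcovZ ∕ savgZ_congr ∕
savgZ_const_mul ∕ tildIterZ_mgauge ∕ tildIterZ_mul`; dag-n05-c's `B8Eq178AveragesRec.rbarZ_restr_iff_uavgZ` ((1.29) ⟺ `uavgZ = 1`).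
`--kind proof --supports stmt-QuantumFields-20541` (K0⁷; count-neutral; no definition).

WHAT IS PROVED (sorry-free).  §0 `inBox_block ∕ inBox_centre` (centred block box).  §1 DICTIONARY: ★`covProdS_eq_tHol` (the signed (1.19)-product IS (58), every word),
`tHol_congr_of_agree` (centred block box), `pert_avgIterZ_eq_tildIterZ` ((1.20) = (69)), ★`ax119_iff_ax67` (the transporter form of (1.19) at a centred block ⟺ (67) there).
§2 ★★`eq84_local` ([3] (84) AT ONE SITE from (67) in the CENTRED tower under it), ★`eq87_local`.  §3 ★★`eq87_of_inAxZ_restr129Z` ((87) at every `y ∈ Λ_j` from the typed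
classes `InAxZ` + `Restr129Z`).  §4 interior bonds: `eq130_lhs`, ★`eq130_interior`, ★★`eq131_interior`, `eq131_interior_expIB`.  §5 crossing bonds: ★`eq130_crossing`,
`eq105_wframeZ`, `dbavg_agree_of_block`, ★★★`eq131_crossing` (the second line of (1.31) LITERALLY in `B8Thm2LogBRec`'s vocabulary: `(U̿₁^{j+1})_b = crossMidZ L Ū₀ʲ V′ⱼ (L•y)
V′_b`), `eq131_crossing_expIB`.  §6 mirrored crossing bonds: `I_smul_crossSumZ`, `eq130_crossing_mirrored`, ★`eq131_crossing_mirrored`, `eq131_crossing_mirrored_expIB`.  §7 THEOREM 2's LINE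
(1.36)–(1.37) on the certified record averages: ★`eq137_interior`, ★★`eq137_crossing` (`exp iB_b = (Ū₁ʲ)_b` AND `|B_b| < 2dLα₁` from (87), `U1`-valued averages and (1.35)).
HONEST SCOPE.  As the engine module's (i)–(iv): identities of the lineage's formal objects; the admissibility geometry is exactly what the hypotheses ask site- and
block-wise; `L = 2s+1` odd where a block must contain its centre; nothing of [3]∕[6]∕[I] beyond these lines asserted; `HThm4Rec` UNDISCHARGED; N05 ∕ N07 NOT discharged; counts
unmoved; one finite 𝕋⁴ programme at fixed ε — nothing continuum ∕ ℝ⁴ ∕ OS ∕ mass gap ∕ Clay.  No `def`, no `instance`, no `notation`, no `sorry`.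
-/

noncomputable section

open NormedSpace Finset

namespace Literature.MathematicalPhysics.QuantumFieldTheory.Balaban1983to89.B8Eq131DerivationRec

open B7Prop1Explicit B7Prop2Explicit MatrixLog B7AvgGaugeCovariance BlockAveragingZd B8Lemma1NonAbelianRecLoops B8Ineq130Rec
open B7Eq92Concrete (mgauge mgauge_apply mgauge_mul tHol tHol_nil Rc Rc_apply)
open B7Eq99Concrete (R0fun R0fun_apply R0fun_self)
open B7Eq84Concrete (eq72_iff_eq76)
open B7SectCDGaugeAveragesRec (savgZ R0avgZ tildIterZ FcovZ wframeZ dbavgCovIterZ vcovZ wrecZ uavgZ uavgZ_zero uavgZ_succ tildIterZ_apply vcovZ_succ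
  wrecZ_zero)
open B7Eq92ConcreteRec (tildIterZ_mgauge tildIterZ_mul)
open B7Eq99ConcreteRec (savgZ_const_mul wrecZ_succ wrecZ_eq_vcovZ eq92Z)
open B7Eq84ConcreteRec (savgZ_congr)
open B7Prop1Local (InBox AgreeOn hol_treeWord_congr)
open B8Ineq130 (inBox_of_le)
open B8Lemma1NonAbelian (pert mulCfg)
open B8Eq119TwistedAxial (mulCfg_eq_mul)
open B8Eq119TwistedAxialRec (UnderZ underZ_zero_iff underZ_one_block underZ_one_centre underZ_succ_of_underZ_block InAxZ Restr129Z)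
open B8Eq178AveragesRec (rbarZ_restr_iff_uavgZ)
open B8Thm2LogB (Bint exp_I_smul_Bint)
open B8Thm2LogBRec (covProdS hol_mulCfg_eq_covProdS_mul crossSumZ crossMidZ BcrossZ BcrossMirrorZ neg_I_smul_crossSumZ exp_I_smul_BcrossZ)
open B8Eq131Derivation (eq117_eq_mgauge mgauge_inv_mgauge)
open Complex (I)

-- `Site` alone would resolve to the torus sites of `Setup.lean`; re-export the `ℤ^d` sites of `B7Prop1Explicit`.
export B7Prop1Explicit (Site)

variable {d : ℕ}

/-! ## §0 The centred block box `[L•y − s𝟙, L•y + s𝟙]` (= the depth-1 cube of `B8Ineq130Rec` under `[y, y]`) -/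

/-- The block point `L•y + offZ L r` lies in the centred block box (odd `L`). [cite: Balaban1987RG1, (0.3) p.252 (bookkeeping)] -/
theorem inBox_block {L s : ℕ} (hL : L = 2 * s + 1) (y : Site d) (r : Fin d → Fin L) :
    InBox ((L : ℤ) • y - halfVec L) ((L : ℤ) • y + halfVec L) ((L : ℤ) • y + offZ L r) := by
  obtain ⟨h1, h2⟩ := block_mem hL (lo := y) (hi := y) (n := 0) le_rfl le_rfl r
  exact inBox_of_le h1 h2

/-- The centre `L•y` lies in the centred block box. [cite: Balaban1987RG1, (0.3) p.252 (bookkeeping)] -/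
theorem inBox_centre (L : ℕ) (y : Site d) :
    InBox ((L : ℤ) • y - halfVec L) ((L : ℤ) • y + halfVec L) ((L : ℤ) • y) := by
  obtain ⟨h1, h2⟩ := smul_mem (L := L) (lo := y) (hi := y) (n := 0) le_rfl le_rfl
  exact inBox_of_le h1 h2

/-! ## §1 Dictionary: B8's (1.17), (1.19), (1.20) in the vocabulary of [3] (55), (58), (67), (69) — centred blocks, signed words -/

section Dictionary

variable {G : Type*} [Group G]

/-- **The SIGNED (1.19)-product IS the twisted transport (58) of [3], on EVERY contour**: `covProdS V₀ V′ x Γ = (V′V₀)(Γ)V₀(Γ)⁻¹` (`B7Eq92Concrete.tHol`) — by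
`B8Thm2LogBRec.hol_mulCfg_eq_covProdS_mul` (engine: `covProd_eq_tHol`, forward contours only). [cite: Balaban1985RegularSpaces, (1.19) p.79; Balaban1985Averaging, (58) p.27] -/
theorem covProdS_eq_tHol (V₀ V' : Site d → Fin d → G) (x : Site d) (w : List (Letter d)) :
    covProdS V₀ V' x w = tHol V₀ V' x w := by
  rw [tHol, ← mulCfg_eq_mul, hol_mulCfg_eq_covProdS_mul V₀ V' x w, mul_inv_cancel_right]

/-- Locality of the twisted transport (58) along a CENTRED block contour: it sees the field only on the bonds of the block box `[L•y − s𝟙, L•y + s𝟙]`.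
[cite: Balaban1985Averaging, (58) p.27; Balaban1985RegularSpaces, p.82 ("All sites of the contours Γ_{b₋,x} belong to Λ_{j−1}"); Balaban1987RG1, (0.3) p.252] -/
theorem tHol_congr_of_agree {L s : ℕ} (hL : L = 2 * s + 1) (V₀ W W' : Site d → Fin d → G) (y : Site d)
    (h : AgreeOn ((L : ℤ) • y - halfVec L) ((L : ℤ) • y + halfVec L) (W * V₀) (W' * V₀)) (r : Fin d → Fin L) :
    tHol V₀ W ((L : ℤ) • y) (treeWord (offZ L r)) = tHol V₀ W' ((L : ℤ) • y) (treeWord (offZ L r)) := by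
  rw [tHol, tHol, hol_treeWord_congr h ((L : ℤ) • y) (offZ L r) (inBox_centre L y) (inBox_block hL y r)]

end Dictionary

section Carriers

variable {𝔸 : Type*} [NormedRing 𝔸] [NormedAlgebra ℂ 𝔸] [CompleteSpace 𝔸]

/-- **(1.20) IS (69) of [3], record averages**: `Ũ′ⁿ = (\overline{U′U₀})ⁿ(Ū₀ⁿ)⁻¹` — `pert` of the record averages is dag-n05-e's `tildIterZ`.
[cite: Balaban1985RegularSpaces, (1.20) p.79; Balaban1985Averaging, (69) p.29; Balaban1987RG1, (0.4) p.253] -/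
theorem pert_avgIterZ_eq_tildIterZ (L : ℕ) (U₀ U' : Site d → Fin d → 𝔸ˣ) (n : ℕ) :
    pert (avgIterZ L (U' * U₀) n) (avgIterZ L U₀ n) = tildIterZ L U₀ U' n := by
  funext z κ
  rfl

/-- **(1.19) at one CENTRED block IS (67) of [3] there**: the transporter form `(\overline{U′U₀})ⁿ(Γ_{Lz,Lz+r}) = Ū₀ⁿ(Γ_{Lz,Lz+r})` of `B8Eq119TwistedAxialRec.InAxZ` ⟺
`(R̄ⁿ_{0,Lz}Ũ′ⁿ)(Γ_{Lz,Lz+r}) = 1` in the `tHol`∕`tildIterZ` typing of dag-n05-e's `AxialGaugeZ`. [cite: Balaban1985RegularSpaces, (1.19) p.79; Balaban1985Averaging, (67) p.29; Balaban1987RG1, (0.3) p.252] -/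
theorem ax119_iff_ax67 (L : ℕ) (U₀ U' : Site d → Fin d → 𝔸ˣ) (n : ℕ) (z : Site d) (r : Fin d → Fin L) :
    axialFn (avgIterZ L (U' * U₀) n) ((L : ℤ) • z) ((L : ℤ) • z + offZ L r)
        = axialFn (avgIterZ L U₀ n) ((L : ℤ) • z) ((L : ℤ) • z + offZ L r)
      ↔ tHol (avgIterZ L U₀ n) (tildIterZ L U₀ U' n) ((L : ℤ) • z) (treeWord (offZ L r)) = 1 := by
  rw [axialFn, axialFn, add_sub_cancel_left, tHol, tildIterZ_mul, mul_inv_eq_one]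

/-! ## §2 [3] (84) and (87) AT ONE SITE, from the axial conditions in the CENTRED tower under it -/

/-- **(84) of [3], LOCALISED, record averages**: `(\overline{R₀u}ʲ)(y) = u_j(y)·w_j(y)` AT THE SITE `y` of the level-`j` lattice as soon as `U′ = U₁ᵘ` satisfies the block
axial gauge conditions (67) = (1.19) on every CENTRED block of the tower `Bʲ(y)` under `y` (levels `n < j`, centres `Lz` with `z ∈ B^{j−n−1}(y)`), odd `L` — print's induction
(dag-n05-e's global `B7Eq84ConcreteRec.eq84Z`) carried out under one site: the step uses the hypothesis at the points of `B(y)` and (76) at the block `B(y)` itself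
(`eq72_iff_eq76`), the multiplicativity of `R` and the left-invariance of the site average (78) (`savgZ_const_mul`).
[cite: Balaban1985Averaging, (84) p.30, (76) p.29, (78) p.30; Balaban1985RegularSpaces, (1.19) p.79, (1.29) p.81; Balaban1987RG1, (0.4) p.253] -/
theorem eq84_local {L s : ℕ} (hL : L = 2 * s + 1) (U₀ U₁ : Site d → Fin d → 𝔸ˣ) (u : Site d → 𝔸ˣ) :
    ∀ (j : ℕ) (y : Site d),
      (∀ n, n < j → ∀ z : Site d, UnderZ L (j - (n + 1)) y z → ∀ r : Fin d → Fin L,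
        tHol (avgIterZ L U₀ n) (tildIterZ L U₀ (mgauge U₀ u U₁) n) ((L : ℤ) • z) (treeWord (offZ L r)) = 1) →
      uavgZ L U₀ u j y = uLev L u j y * wrecZ L U₀ U₁ j y
  | 0, y, _ => by simp
  | j + 1, y, hax => by
    have hLo : Odd L := ⟨s, hL⟩
    -- the hypothesis descends to every level-`j` site `x ∈ B(y)` (its tower lies in the tower of `y`)
    have hIH : ∀ x : Site d, UnderZ L 1 y x → uavgZ L U₀ u j x = uLev L u j x * wrecZ L U₀ U₁ j x := by
      intro x hx
      refine eq84_local hL U₀ U₁ u j x fun n hn z hz r => hax n (Nat.lt_succ_of_lt hn) z ?_ r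
      have e1 : j + 1 - (n + 1) = (j - (n + 1)) + 1 := by omega
      rw [e1]
      exact underZ_succ_of_underZ_block hLo hx hz
    -- (76) on the block `B(y)` from the axial condition (67) at level `j`, centre `Ly` (`n = j`, `z = y`)
    have h76 : ∀ r : Fin d → Fin L,
        R0fun (avgIterZ L U₀ j) ((L : ℤ) • y) (uLev L u j) ((L : ℤ) • y + offZ L r)
          = uLev L u j ((L : ℤ) • y)
            * tHol (avgIterZ L U₀ j) (tildIterZ L U₀ U₁ j) ((L : ℤ) • y) (treeWord (offZ L r)) := by
      intro r
      have h := hax j (Nat.lt_succ_self j) y (by rw [Nat.sub_self]; exact (underZ_zero_iff L y y).2 rfl) r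
      rw [tildIterZ_mgauge] at h
      have h' := (eq72_iff_eq76 (avgIterZ L U₀ j) (tildIterZ L U₀ U₁ j) (uLev L u j) ((L : ℤ) • y)
        ((L : ℤ) • y + offZ L r)).1
      rw [add_sub_cancel_left] at h'
      exact h' h
    rw [uavgZ_succ, R0avgZ, wrecZ_succ, ← uLev_smul L u j y, ← savgZ_const_mul]
    apply savgZ_congr
    · rw [R0fun_self, R0fun_self, sub_self, treeWord_zero, tHol_nil, one_mul]
      exact hIH _ (underZ_one_centre L y)
    · intro r
      have h76r := h76 r
      rw [R0fun_apply, add_sub_cancel_left] at h76r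
      simp only [R0fun_apply, add_sub_cancel_left, hIH _ (underZ_one_block hL y r), map_mul, h76r, mul_assoc]

/-- **(87) of [3] AT ONE SITE, record averages**: (1.29) AT `y ∈ Λ_j` — `uavgZ L U₀ u j y = 1` — together with the axial conditions (1.19) in the centred tower under `y`
determines `u` at `y` «in terms of the configuration U₁»: `u_j(y) = w_j(y)⁻¹`, `w_j` dag-n05-e's `wrecZ` (= `vcovZ` by (99) `wrecZ_eq_vcovZ`).
[cite: Balaban1985Averaging, (86)–(87) p.31, (84) p.30; Balaban1985RegularSpaces, (1.29) p.81] -/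
theorem eq87_local {L s : ℕ} (hL : L = 2 * s + 1) (U₀ U₁ : Site d → Fin d → 𝔸ˣ) (u : Site d → 𝔸ˣ) (j : ℕ) (y : Site d)
    (hax : ∀ n, n < j → ∀ z : Site d, UnderZ L (j - (n + 1)) y z → ∀ r : Fin d → Fin L,
      tHol (avgIterZ L U₀ n) (tildIterZ L U₀ (mgauge U₀ u U₁) n) ((L : ℤ) • z) (treeWord (offZ L r)) = 1)
    (h129 : uavgZ L U₀ u j y = 1) : uLev L u j y = (wrecZ L U₀ U₁ j y)⁻¹ := by
  rw [eq84_local hL U₀ U₁ u j y hax, mul_eq_one_iff_eq_inv] at h129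
  exact h129

/-! ## §3 (87) at every site of `𝔅_k` from the TYPED classes (1.19) `InAxZ` and (1.29) `Restr129Z` -/

/-- **p. 81 «In [3] we have determined the gauge transformation u in terms of the configuration U₁» for the typed RECORD classes**: if `U′U₀ ∈ Ax_k(𝔅_k, U₀)` in the
sense of `B8Eq119TwistedAxialRec.InAxZ` ((1.19), transporter form, in the centred towers under the sites of `Λ_j`), `U′ = U₁ᵘ` ((1.17)∕(55)), and `u` satisfies (1.29)
`Restr129Z` (`(\overline{R₀u}ʲ)(y) = 1`, `y ∈ Λ_j`, `j ≤ k`; ⟺ `uavgZ = 1` by dag-n05-c's `rbarZ_restr_iff_uavgZ`), then (87) holds at every `y ∈ Λ_j`, `j ≤ k`: `u_j(y) =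
w_j(y)⁻¹`, odd `L`. [cite: Balaban1985RegularSpaces, (1.29) p.81, (1.19) p.79, (1.14) p.78; Balaban1985Averaging, (87) p.31; Balaban1987RG1, (0.4) p.253] -/
theorem eq87_of_inAxZ_restr129Z {L s : ℕ} (hL : L = 2 * s + 1) (k : ℕ) (Λ : ℕ → Set (Site d))
    (U₀ U₁ : Site d → Fin d → 𝔸ˣ) (u : Site d → 𝔸ˣ)
    (hAx : InAxZ L k Λ U₀ (mgauge U₀ u U₁ * U₀)) (h129 : Restr129Z L k Λ U₀ u) :
    ∀ j, j ≤ k → ∀ y ∈ Λ j, uLev L u j y = (wrecZ L U₀ U₁ j y)⁻¹ := by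
  intro j hjk y hy
  unfold Restr129Z at h129
  rw [rbarZ_restr_iff_uavgZ] at h129
  refine eq87_local hL U₀ U₁ u j y (fun n hn z hz r => ?_) (h129 j hjk y hy)
  have h1 : 1 ≤ j := by omega
  exact (ax119_iff_ax67 L U₀ (mgauge U₀ u U₁) n z r).1 (hAx j h1 hjk y hy n hn z hz r)

/-! ## §4 (1.30) and the first line of (1.31): interior bonds `b₋, b₊ ∈ Λ_j` -/

/-- **(1.30), first equality, record averages** — (70)∕(71) of [3] for `U′ = U₁ᵘ` (a pointer to dag-n05-e's `tildIterZ_mgauge`).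
[cite: Balaban1985RegularSpaces, (1.30) p.81; Balaban1985Averaging, (70)–(71) p.29] -/
theorem eq130_lhs (L : ℕ) (U₀ U₁ : Site d → Fin d → 𝔸ˣ) (u : Site d → 𝔸ˣ) (j : ℕ) (y : Site d) (κ : Fin d) :
    tildIterZ L U₀ (mgauge U₀ u U₁) j y κ
      = uLev L u j y * tildIterZ L U₀ U₁ j y κ * (Rc (avgIterZ L U₀ j y κ) (uLev L u j (y + e κ)))⁻¹ := by
  rw [tildIterZ_mgauge, mgauge_apply]

/-- **p. 81 «If both end-points b₋, b₊ of a bond b belong to Λ_j, then the expression on the left-hand side of (1.30) is equal to (Ū₁ʲ)_b by (92) of [3]», record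
averages**: with (87) at `b₋` and at `b₊`, `Ũ′ʲ_b = w_j(b₋)⁻¹(Ũ₁ʲ)_b R̄ʲ_{0,b} w_j(b₊) = (U̿₁ʲ)_b` (dag-n05-e's `eq92Z`).
[cite: Balaban1985RegularSpaces, (1.30) p.81; Balaban1985Averaging, (92) p.31, (87)–(88) p.31] -/
theorem eq130_interior (L : ℕ) (U₀ U₁ : Site d → Fin d → 𝔸ˣ) (u : Site d → 𝔸ˣ) (j : ℕ) (y : Site d) (κ : Fin d)
    (hm : uLev L u j y = (wrecZ L U₀ U₁ j y)⁻¹) (hp : uLev L u j (y + e κ) = (wrecZ L U₀ U₁ j (y + e κ))⁻¹) :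
    tildIterZ L U₀ (mgauge U₀ u U₁) j y κ = dbavgCovIterZ L U₀ U₁ j y κ := by
  rw [tildIterZ_mgauge, mgauge_apply, hm, hp, map_inv, inv_inv, ← eq92Z L U₀ U₁ j y κ]

/-- **(1.31), FIRST LINE, record averages** «(Ū₁ʲ)_b = V′_b, if b ⊂ Λ_j», `V′ = V(Ū₀ʲ)⁻¹`: by `eq130_interior` and the membership (1.13)∕(1.30) `(\overline{U′U₀})ʲ_b = V_b`
at the bond. [cite: Balaban1985RegularSpaces, (1.31) p.82, (1.30) p.81, (1.13) p.78] -/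
theorem eq131_interior (L : ℕ) (U₀ U₁ : Site d → Fin d → 𝔸ˣ) (u : Site d → 𝔸ˣ) (j : ℕ) (y : Site d) (κ : Fin d)
    (hm : uLev L u j y = (wrecZ L U₀ U₁ j y)⁻¹) (hp : uLev L u j (y + e κ) = (wrecZ L U₀ U₁ j (y + e κ))⁻¹)
    (V : Site d → Fin d → 𝔸ˣ) (h13 : avgIterZ L (mgauge U₀ u U₁ * U₀) j y κ = V y κ) :
    dbavgCovIterZ L U₀ U₁ j y κ = V y κ * (avgIterZ L U₀ j y κ)⁻¹ := by
  rw [← eq130_interior L U₀ U₁ u j y κ hm hp, tildIterZ_apply, h13]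

/-- **(1.31), first line, complete, record averages**: «(Ū₁ʲ)_b = V′_b = exp iB_b, if b ⊂ Λ_j» — `B_b = (1/i) log V′_b` (`B8Thm2LogB.Bint`, pointwise, reused) inside the
domain `|V′_b − 1| < 1` of the series logarithm. [cite: Balaban1985RegularSpaces, (1.31) p.82] -/
theorem eq131_interior_expIB (L : ℕ) (U₀ U₁ : Site d → Fin d → 𝔸ˣ) (u : Site d → 𝔸ˣ) (j : ℕ) (y : Site d)
    (κ : Fin d) (hm : uLev L u j y = (wrecZ L U₀ U₁ j y)⁻¹) (hp : uLev L u j (y + e κ) = (wrecZ L U₀ U₁ j (y + e κ))⁻¹)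
    (V : Site d → Fin d → 𝔸ˣ) (h13 : avgIterZ L (mgauge U₀ u U₁ * U₀) j y κ = V y κ)
    (hsmall : ‖((V y κ * (avgIterZ L U₀ j y κ)⁻¹ : 𝔸ˣ) : 𝔸) - 1‖ < 1) :
    ((dbavgCovIterZ L U₀ U₁ j y κ : 𝔸ˣ) : 𝔸) = exp (I • Bint (V y κ * (avgIterZ L U₀ j y κ)⁻¹)) := by
  rw [eq131_interior L U₀ U₁ u j y κ hm hp V h13, exp_I_smul_Bint hsmall]

/-! ## §5 The crossing bonds `b₋ ∈ Λ_{j−1}`, `b₊ ∈ Λ_j` (stated one level up: `j ↦ j + 1`), centred blocks -/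

/-- **p. 81 «the formulas (97), (99), and (87) of [3] imply (Ũ₁^{u j})_b = \overline{R̄^{j−1}_{0,b₋}Ū₁^{j−1}}(Ū₁ʲ)_b», record averages** — for a level-`(j+1)` bond
`b = ⟨y, y + e_κ⟩` with (87) at `b₊` and at `b₋` READ ONE LEVEL DOWN (the centre `L•y`, a `Λ_j`-site): `Ũ′^{j+1}_b = \overline{R̄ʲ_{0,b₋}U̿₁ʲ}·(U̿₁^{j+1})_b`, the factor being
dag-n05-e's block frame `wframeZ` of `U̿₁ʲ` at `Ū₀ʲ` ((97)∕(99): `vcovZ_succ`, `wrecZ_eq_vcovZ`; (92): `eq92Z`).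
[cite: Balaban1985RegularSpaces, (1.30)–(1.31) pp.81–82; Balaban1985Averaging, (97) p.32, (99) p.32, (87) p.31, (92) p.31] -/
theorem eq130_crossing (L : ℕ) (U₀ U₁ : Site d → Fin d → 𝔸ˣ) (u : Site d → 𝔸ˣ) (j : ℕ) (y : Site d) (κ : Fin d)
    (hm : uLev L u j ((L : ℤ) • y) = (wrecZ L U₀ U₁ j ((L : ℤ) • y))⁻¹)
    (hp : uLev L u (j + 1) (y + e κ) = (wrecZ L U₀ U₁ (j + 1) (y + e κ))⁻¹) :
    tildIterZ L U₀ (mgauge U₀ u U₁) (j + 1) y κ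
      = wframeZ L (avgIterZ L U₀ j) (dbavgCovIterZ L U₀ U₁ j) ((L : ℤ) • y) * dbavgCovIterZ L U₀ U₁ (j + 1) y κ := by
  rw [tildIterZ_mgauge, mgauge_apply, ← uLev_smul L u j y, hm, hp, map_inv, inv_inv, ← eq92Z L U₀ U₁ (j + 1) y κ,
    wrecZ_eq_vcovZ L U₀ U₁ j, wrecZ_eq_vcovZ L U₀ U₁ (j + 1), vcovZ_succ L U₀ U₁ j y]
  group

/-- **(105) of [3]** for that factor, centred blocks: `\overline{R̄_{0,b₋}U̿₁} = exp[Σ_{x∈B(b₋)} L^{−d} log(R̄_{0,b₋}U̿₁)(Γ_{b₋,x})]` (the block points `x = L•y + offZ L r`; cf.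
dag-n05-e's `eq105Z`). [cite: Balaban1985RegularSpaces, p.81 (display after (1.30)); Balaban1985Averaging, (105) p.33, (82) p.30; Balaban1987RG1, (0.3) p.252] -/
theorem eq105_wframeZ (L : ℕ) (V₀ W : Site d → Fin d → 𝔸ˣ) (q : Site d) :
    ((wframeZ L V₀ W q : 𝔸ˣ) : 𝔸)
      = exp (∑ r : Fin d → Fin L, (((L : ℝ) ^ d)⁻¹)
          • mlog ((tHol V₀ W q (treeWord (offZ L r)) : 𝔸ˣ) : 𝔸)) := rfl

/-- **p. 82 «All sites of the contours Γ_{b₋,x} belong to Λ_{j−1}, hence Ū₁^{j−1} in the above formula is equal to V(Ū₀^{j−1})⁻¹»** — on the CENTRED block box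
`[L•y − s𝟙, L•y + s𝟙]` of level-`j` sites: (87) at its sites and (1.13) on its bonds give `U̿₁ʲŪ₀ʲ = V` there. [cite: Balaban1985RegularSpaces, (1.31) p.82, (1.13) p.78; Balaban1985Averaging, (92) p.31] -/
theorem dbavg_agree_of_block (L : ℕ) (U₀ U₁ : Site d → Fin d → 𝔸ˣ) (u : Site d → 𝔸ˣ) (j : ℕ) (y : Site d)
    (V : Site d → Fin d → 𝔸ˣ)
    (h87 : ∀ x : Site d, InBox ((L : ℤ) • y - halfVec L) ((L : ℤ) • y + halfVec L) x → uLev L u j x = (wrecZ L U₀ U₁ j x)⁻¹)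
    (h13 : AgreeOn ((L : ℤ) • y - halfVec L) ((L : ℤ) • y + halfVec L) (avgIterZ L (mgauge U₀ u U₁ * U₀) j) V) :
    AgreeOn ((L : ℤ) • y - halfVec L) ((L : ℤ) • y + halfVec L) (dbavgCovIterZ L U₀ U₁ j * avgIterZ L U₀ j) V := by
  intro x κ hx hxκ
  simp only [Pi.mul_apply]
  rw [eq131_interior L U₀ U₁ u j x κ (h87 x hx) (h87 _ hxκ) V (h13 x κ hx hxκ), inv_mul_cancel_right]

/-- **(1.31), SECOND LINE, RECORD AVERAGES, IN THE VOCABULARY OF `B8Thm2LogBRec`** (`crossMidZ L V₀ V′ q w = exp[−i·crossSumZ] w`, `crossSumZ` built on the SIGNED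
(1.19)-product `covProdS` along the centred block contours): for a level-`(j+1)` bond `b = ⟨y, y + e_κ⟩` with (87) at `b₊`, (87) and (1.13) on the centred block box of `b₋ =
L•y` («All sites of the contours Γ_{b₋,x} belong to Λ_{j−1}»), and (1.13) at `b`: `(U̿₁^{j+1})_b = crossMidZ L Ū₀ʲ V′ⱼ (L•y) V′_b`, `V′ⱼ = V_j(Ū₀ʲ)⁻¹`, `V′_b = V_b(Ū₀^{j+1})_b⁻¹`,
odd `L`. [cite: Balaban1985RegularSpaces, (1.31) p.82, (1.30) p.81, (1.13) p.78; Balaban1985Averaging, (105) p.33, (92) p.31, (97) p.32, (99) p.32, (87) p.31; Balaban1987RG1, (0.3)–(0.4) pp.252–253] -/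
theorem eq131_crossing {L s : ℕ} (hL : L = 2 * s + 1) (U₀ U₁ : Site d → Fin d → 𝔸ˣ) (u : Site d → 𝔸ˣ) (j : ℕ) (y : Site d)
    (κ : Fin d) (Vj V : Site d → Fin d → 𝔸ˣ)
    (h87 : ∀ x : Site d, InBox ((L : ℤ) • y - halfVec L) ((L : ℤ) • y + halfVec L) x → uLev L u j x = (wrecZ L U₀ U₁ j x)⁻¹)
    (h13j : AgreeOn ((L : ℤ) • y - halfVec L) ((L : ℤ) • y + halfVec L) (avgIterZ L (mgauge U₀ u U₁ * U₀) j) Vj)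
    (hp : uLev L u (j + 1) (y + e κ) = (wrecZ L U₀ U₁ (j + 1) (y + e κ))⁻¹)
    (h13 : avgIterZ L (mgauge U₀ u U₁ * U₀) (j + 1) y κ = V y κ) :
    ((dbavgCovIterZ L U₀ U₁ (j + 1) y κ : 𝔸ˣ) : 𝔸)
      = crossMidZ L (avgIterZ L U₀ j) (pert Vj (avgIterZ L U₀ j)) ((L : ℤ) • y)
          (V y κ * (avgIterZ L U₀ (j + 1) y κ)⁻¹) := by
  have h130 := eq130_crossing L U₀ U₁ u j y κ (h87 _ (inBox_centre L y)) hp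
  rw [tildIterZ_apply, h13] at h130
  have hsol : dbavgCovIterZ L U₀ U₁ (j + 1) y κ
      = (wframeZ L (avgIterZ L U₀ j) (dbavgCovIterZ L U₀ U₁ j) ((L : ℤ) • y))⁻¹
          * (V y κ * (avgIterZ L U₀ (j + 1) y κ)⁻¹) := by
    rw [h130, inv_mul_cancel_left]
  have hpert : pert Vj (avgIterZ L U₀ j) * avgIterZ L U₀ j = Vj := by
    funext x μ
    simp only [Pi.mul_apply, pert, inv_mul_cancel_right]
  have hagree : AgreeOn ((L : ℤ) • y - halfVec L) ((L : ℤ) • y + halfVec L)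
      (dbavgCovIterZ L U₀ U₁ j * avgIterZ L U₀ j) (pert Vj (avgIterZ L U₀ j) * avgIterZ L U₀ j) := by
    rw [hpert]
    exact dbavg_agree_of_block L U₀ U₁ u j y Vj h87 h13j
  have hF : FcovZ L (avgIterZ L U₀ j) (dbavgCovIterZ L U₀ U₁ j) ((L : ℤ) • y)
      = ∑ r : Fin d → Fin L, (((L : ℝ) ^ d)⁻¹) •
          mlog ((covProdS (avgIterZ L U₀ j) (pert Vj (avgIterZ L U₀ j)) ((L : ℤ) • y) (treeWord (offZ L r)) : 𝔸ˣ) : 𝔸) := by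
    unfold FcovZ
    refine Finset.sum_congr rfl fun r _ => ?_
    rw [tHol_congr_of_agree hL _ _ _ y hagree r, covProdS_eq_tHol]
  rw [hsol, Units.val_mul, wframeZ, val_inv_expUnit, val_expUnit, hF, crossMidZ, neg_I_smul_crossSumZ]

/-- **(1.31), second line, complete, record averages**: «(Ū₁ʲ)_b = exp[−i Σ …] V′_b = exp iB_b» — `B_b = B8Thm2LogBRec.BcrossZ …` inside the domain of the series logarithm.
[cite: Balaban1985RegularSpaces, (1.31) p.82] -/
theorem eq131_crossing_expIB {L s : ℕ} (hL : L = 2 * s + 1) (U₀ U₁ : Site d → Fin d → 𝔸ˣ) (u : Site d → 𝔸ˣ) (j : ℕ)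
    (y : Site d) (κ : Fin d) (Vj V : Site d → Fin d → 𝔸ˣ)
    (h87 : ∀ x : Site d, InBox ((L : ℤ) • y - halfVec L) ((L : ℤ) • y + halfVec L) x → uLev L u j x = (wrecZ L U₀ U₁ j x)⁻¹)
    (h13j : AgreeOn ((L : ℤ) • y - halfVec L) ((L : ℤ) • y + halfVec L) (avgIterZ L (mgauge U₀ u U₁ * U₀) j) Vj)
    (hp : uLev L u (j + 1) (y + e κ) = (wrecZ L U₀ U₁ (j + 1) (y + e κ))⁻¹)
    (h13 : avgIterZ L (mgauge U₀ u U₁ * U₀) (j + 1) y κ = V y κ)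
    (hsmall : ‖crossMidZ L (avgIterZ L U₀ j) (pert Vj (avgIterZ L U₀ j)) ((L : ℤ) • y)
        (V y κ * (avgIterZ L U₀ (j + 1) y κ)⁻¹) - 1‖ < 1) :
    ((dbavgCovIterZ L U₀ U₁ (j + 1) y κ : 𝔸ˣ) : 𝔸)
      = exp (I • BcrossZ L (avgIterZ L U₀ j) (pert Vj (avgIterZ L U₀ j)) ((L : ℤ) • y)
          (V y κ * (avgIterZ L U₀ (j + 1) y κ)⁻¹)) := by
  rw [eq131_crossing hL U₀ U₁ u j y κ Vj V h87 h13j hp h13, exp_I_smul_BcrossZ L _ _ _ hsmall]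

/-! ## §6 The MIRRORED crossing bonds `b₋ ∈ Λ_j`, `b₊ ∈ Λ_{j−1}` (stated one level up), centred blocks -/

omit [CompleteSpace 𝔸] in
/-- `i · Σ_x L^{−d} (1/i) log P_x = Σ_x L^{−d} log P_x`: the exponent of `BcrossMirrorZ` is the block exp-mean-log (105) itself (companion of `neg_I_smul_crossSumZ`).
[cite: Balaban1985RegularSpaces, (1.31) p.82; Balaban1985Averaging, (105) p.33] -/
theorem I_smul_crossSumZ (L : ℕ) (V₀ V' : Site d → Fin d → 𝔸ˣ) (q : Site d) :
    I • crossSumZ L V₀ V' q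
      = ∑ r : Fin d → Fin L, (((L : ℝ) ^ d)⁻¹)
          • mlog ((covProdS V₀ V' q (treeWord (offZ L r)) : 𝔸ˣ) : 𝔸) := by
  rw [crossSumZ, Finset.smul_sum]
  refine Finset.sum_congr rfl fun r _ => ?_
  rw [smul_comm, smul_smul, mul_inv_cancel₀ Complex.I_ne_zero, one_smul]

/-- **(1.30) on a MIRRORED crossing bond, record averages** (`b₋ ∈ Λ_j`, `b₊ ∈ Λ_{j−1}`): for a level-`(j+1)` bond `b = ⟨y, y + e_κ⟩` with (87) at `b₋` (level `j + 1`) and at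
`b₊` READ ONE LEVEL DOWN (the centre `L•(y + e_κ)`): `Ũ′^{j+1}_b = (U̿₁^{j+1})_b · [R̄^{j+1}_{0,b}(\overline{R̄ʲ_{0,b₊}U̿₁ʲ})]⁻¹`.
[cite: Balaban1985RegularSpaces, (1.30)–(1.31) pp.81–82; Balaban1985Averaging, (97) p.32, (99) p.32, (87) p.31, (92) p.31] -/
theorem eq130_crossing_mirrored (L : ℕ) (U₀ U₁ : Site d → Fin d → 𝔸ˣ) (u : Site d → 𝔸ˣ) (j : ℕ) (y : Site d)
    (κ : Fin d) (hm : uLev L u (j + 1) y = (wrecZ L U₀ U₁ (j + 1) y)⁻¹)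
    (hp : uLev L u j ((L : ℤ) • (y + e κ)) = (wrecZ L U₀ U₁ j ((L : ℤ) • (y + e κ)))⁻¹) :
    tildIterZ L U₀ (mgauge U₀ u U₁) (j + 1) y κ
      = dbavgCovIterZ L U₀ U₁ (j + 1) y κ
          * (Rc (avgIterZ L U₀ (j + 1) y κ)
              (wframeZ L (avgIterZ L U₀ j) (dbavgCovIterZ L U₀ U₁ j) ((L : ℤ) • (y + e κ))))⁻¹ := by
  rw [tildIterZ_mgauge, mgauge_apply, ← uLev_smul L u j (y + e κ), hm, hp, ← eq92Z L U₀ U₁ (j + 1) y κ,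
    wrecZ_eq_vcovZ L U₀ U₁ j, wrecZ_eq_vcovZ L U₀ U₁ (j + 1), vcovZ_succ L U₀ U₁ j (y + e κ)]
  simp only [map_mul, map_inv, inv_inv]
  group

/-- **(1.31), second line, MIRRORED, record averages** in the vocabulary of `B8Thm2LogBRec.BcrossMirrorZ`: for a level-`(j+1)` bond `b = ⟨y, y + e_κ⟩` with (87) at `b₋`, (87) and
(1.13) on the CENTRED block box of `b₊ = L•(y + e_κ)`, and (1.13) at `b`: `(U̿₁^{j+1})_b = V′_b · (g · exp[i·crossSumZ L Ū₀ʲ V′ⱼ (L•b₊)] · g⁻¹)`, `V′_b = V_b g⁻¹`,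
`g = Ū₀^{j+1}(b)`, `V′ⱼ = V_j(Ū₀ʲ)⁻¹` — the argument of `log` in `BcrossMirrorZ L Ū₀ʲ V′ⱼ (L•b₊) g V′_b`, odd `L`.
[cite: Balaban1985RegularSpaces, (1.31) p.82, (1.13) p.78; Balaban1985Averaging, (105) p.33, (92) p.31; Balaban1987RG1, (0.3)–(0.4) pp.252–253] -/
theorem eq131_crossing_mirrored {L s : ℕ} (hL : L = 2 * s + 1) (U₀ U₁ : Site d → Fin d → 𝔸ˣ) (u : Site d → 𝔸ˣ) (j : ℕ)
    (y : Site d) (κ : Fin d) (Vj V : Site d → Fin d → 𝔸ˣ)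
    (hm : uLev L u (j + 1) y = (wrecZ L U₀ U₁ (j + 1) y)⁻¹)
    (h87 : ∀ x : Site d, InBox ((L : ℤ) • (y + e κ) - halfVec L) ((L : ℤ) • (y + e κ) + halfVec L) x →
      uLev L u j x = (wrecZ L U₀ U₁ j x)⁻¹)
    (h13j : AgreeOn ((L : ℤ) • (y + e κ) - halfVec L) ((L : ℤ) • (y + e κ) + halfVec L) (avgIterZ L (mgauge U₀ u U₁ * U₀) j) Vj)
    (h13 : avgIterZ L (mgauge U₀ u U₁ * U₀) (j + 1) y κ = V y κ) :
    ((dbavgCovIterZ L U₀ U₁ (j + 1) y κ : 𝔸ˣ) : 𝔸)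
      = ((V y κ * (avgIterZ L U₀ (j + 1) y κ)⁻¹ : 𝔸ˣ) : 𝔸)
          * (((avgIterZ L U₀ (j + 1) y κ : 𝔸ˣ) : 𝔸)
              * exp (I • crossSumZ L (avgIterZ L U₀ j) (pert Vj (avgIterZ L U₀ j)) ((L : ℤ) • (y + e κ)))
              * (((avgIterZ L U₀ (j + 1) y κ)⁻¹ : 𝔸ˣ) : 𝔸)) := by
  have hp : uLev L u j ((L : ℤ) • (y + e κ)) = (wrecZ L U₀ U₁ j ((L : ℤ) • (y + e κ)))⁻¹ :=
    h87 _ (inBox_centre L (y + e κ))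
  have h130 := eq130_crossing_mirrored L U₀ U₁ u j y κ hm hp
  rw [tildIterZ_apply, h13] at h130
  have hsol : dbavgCovIterZ L U₀ U₁ (j + 1) y κ
      = V y κ * (avgIterZ L U₀ (j + 1) y κ)⁻¹
          * Rc (avgIterZ L U₀ (j + 1) y κ)
              (wframeZ L (avgIterZ L U₀ j) (dbavgCovIterZ L U₀ U₁ j) ((L : ℤ) • (y + e κ))) := by
    rw [h130, inv_mul_cancel_right]
  have hpert : pert Vj (avgIterZ L U₀ j) * avgIterZ L U₀ j = Vj := by
    funext x μ
    simp only [Pi.mul_apply, pert, inv_mul_cancel_right]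
  have hagree : AgreeOn ((L : ℤ) • (y + e κ) - halfVec L) ((L : ℤ) • (y + e κ) + halfVec L)
      (dbavgCovIterZ L U₀ U₁ j * avgIterZ L U₀ j) (pert Vj (avgIterZ L U₀ j) * avgIterZ L U₀ j) := by
    rw [hpert]
    exact dbavg_agree_of_block L U₀ U₁ u j (y + e κ) Vj h87 h13j
  have hF : FcovZ L (avgIterZ L U₀ j) (dbavgCovIterZ L U₀ U₁ j) ((L : ℤ) • (y + e κ))
      = ∑ r : Fin d → Fin L, (((L : ℝ) ^ d)⁻¹) •
          mlog ((covProdS (avgIterZ L U₀ j) (pert Vj (avgIterZ L U₀ j)) ((L : ℤ) • (y + e κ))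
            (treeWord (offZ L r)) : 𝔸ˣ) : 𝔸) := by
    unfold FcovZ
    refine Finset.sum_congr rfl fun r _ => ?_
    rw [tHol_congr_of_agree hL _ _ _ (y + e κ) hagree r, covProdS_eq_tHol]
  rw [hsol]
  simp only [Units.val_mul, Rc_apply, wframeZ, val_expUnit, hF, ← I_smul_crossSumZ]

/-- … and `= exp iB_b` with `B_b = B8Thm2LogBRec.BcrossMirrorZ L Ū₀ʲ V′ⱼ (L•b₊) g V′_b` inside the domain of the series logarithm, record averages.
[cite: Balaban1985RegularSpaces, (1.31) p.82] -/
theorem eq131_crossing_mirrored_expIB {L s : ℕ} (hL : L = 2 * s + 1) (U₀ U₁ : Site d → Fin d → 𝔸ˣ) (u : Site d → 𝔸ˣ)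
    (j : ℕ) (y : Site d) (κ : Fin d) (Vj V : Site d → Fin d → 𝔸ˣ)
    (hm : uLev L u (j + 1) y = (wrecZ L U₀ U₁ (j + 1) y)⁻¹)
    (h87 : ∀ x : Site d, InBox ((L : ℤ) • (y + e κ) - halfVec L) ((L : ℤ) • (y + e κ) + halfVec L) x →
      uLev L u j x = (wrecZ L U₀ U₁ j x)⁻¹)
    (h13j : AgreeOn ((L : ℤ) • (y + e κ) - halfVec L) ((L : ℤ) • (y + e κ) + halfVec L) (avgIterZ L (mgauge U₀ u U₁ * U₀) j) Vj)
    (h13 : avgIterZ L (mgauge U₀ u U₁ * U₀) (j + 1) y κ = V y κ)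
    (hsmall : ‖((V y κ * (avgIterZ L U₀ (j + 1) y κ)⁻¹ : 𝔸ˣ) : 𝔸)
          * (((avgIterZ L U₀ (j + 1) y κ : 𝔸ˣ) : 𝔸)
              * exp (I • crossSumZ L (avgIterZ L U₀ j) (pert Vj (avgIterZ L U₀ j)) ((L : ℤ) • (y + e κ)))
              * (((avgIterZ L U₀ (j + 1) y κ)⁻¹ : 𝔸ˣ) : 𝔸)) - 1‖ < 1) :
    ((dbavgCovIterZ L U₀ U₁ (j + 1) y κ : 𝔸ˣ) : 𝔸)
      = exp (I • BcrossMirrorZ L (avgIterZ L U₀ j) (pert Vj (avgIterZ L U₀ j)) ((L : ℤ) • (y + e κ))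
          (avgIterZ L U₀ (j + 1) y κ) (V y κ * (avgIterZ L U₀ (j + 1) y κ)⁻¹)) := by
  rw [eq131_crossing_mirrored hL U₀ U₁ u j y κ Vj V hm h87 h13j h13, BcrossMirrorZ, smul_smul,
    mul_inv_cancel₀ Complex.I_ne_zero, one_smul, exp_mlog hsmall]

end Carriers

/-! ## §7 Theorem 2's line (1.36)–(1.37): «Q_j(U₀, ηA) = B on Λ_j, B given by (1.31) with V′ = Ũ′ʲ, |B| < 2dLα₁ by (1.35)» — ON THE CERTIFIED RECORD AVERAGES -/

section Thm2Line

variable {𝔸 : Type*} [NormedRing 𝔸] [NormOneClass 𝔸] [NormedAlgebra ℂ 𝔸] [CompleteSpace 𝔸]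

/-- **(1.36)–(1.37) on an interior bond, record averages**: with `B_b := (1/i) log Ũ′ʲ_b`, (87) at `b₋`, `b₊`, `Ū₀ʲ_b ∈ U1` and (1.35) `|(U′U₀)‾ʲ_b − Ū₀ʲ_b| ≤ α₁`:
`exp iB_b = (Ū₁ʲ)_b` AND `|B_b| < 2dLα₁` (`B8Thm2LogB.ineq137_interior`, pointwise). [cite: Balaban1985RegularSpaces, (1.36)–(1.37) p.82, (1.35) p.82, (1.31) p.82] -/
theorem eq137_interior (L : ℕ) (hd : 1 ≤ d) (hL : 1 ≤ L) (U₀ U₁ : Site d → Fin d → 𝔸ˣ) (u : Site d → 𝔸ˣ) (j : ℕ)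
    (y : Site d) (κ : Fin d) (hm : uLev L u j y = (wrecZ L U₀ U₁ j y)⁻¹)
    (hp : uLev L u j (y + e κ) = (wrecZ L U₀ U₁ j (y + e κ))⁻¹) (h₀ : avgIterZ L U₀ j y κ ∈ U1 𝔸) {α₁ : ℝ}
    (hα : 0 < α₁) (hsmall : (d : ℝ) * L * α₁ ≤ 1 / 8)
    (h135 : ‖(avgIterZ L (mgauge U₀ u U₁ * U₀) j y κ : 𝔸) - (avgIterZ L U₀ j y κ : 𝔸)‖ ≤ α₁) :
    exp (I • Bint (tildIterZ L U₀ (mgauge U₀ u U₁) j y κ)) = ((dbavgCovIterZ L U₀ U₁ j y κ : 𝔸ˣ) : 𝔸)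
      ∧ ‖Bint (tildIterZ L U₀ (mgauge U₀ u U₁) j y κ)‖ < 2 * d * L * α₁ := by
  have hw : ‖((tildIterZ L U₀ (mgauge U₀ u U₁) j y κ : 𝔸ˣ) : 𝔸) - 1‖ ≤ α₁ := by
    rw [tildIterZ_apply]
    exact (B8Thm2LogB.norm_mul_inv_sub_one_le _ h₀).trans h135
  have hd' : (1 : ℝ) ≤ d := by exact_mod_cast hd
  have hL' : (1 : ℝ) ≤ L := by exact_mod_cast hL
  have hdL : (1 : ℝ) ≤ (d : ℝ) * L := by nlinarith
  have hα1 : α₁ < 1 := by nlinarith [mul_nonneg (sub_nonneg.2 hdL) hα.le]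
  refine ⟨?_, B8Thm2LogB.ineq137_interior L hd hL hα hsmall hw⟩
  rw [exp_I_smul_Bint (hw.trans_lt hα1), eq130_interior L U₀ U₁ u j y κ hm hp]

/-- **(1.36)–(1.37) on a crossing bond, record averages** (stated one level up): with `B_b := B8Thm2LogBRec.BcrossZ L Ū₀ʲ Ũ′ʲ (L•y) Ũ′^{j+1}_b` ((1.31) second line with
`V′ = Ũ′`), (87) at the sites of the CENTRED block box of `b₋` and at `b₊`, `U1`-valued record averages and (1.35) on the bonds of that box (level `j`) and at `b` (level
`j + 1`) — exactly the data of `B8Thm2LogBRec.ineq137_of_ineq135` —: `exp iB_b = (Ū₁^{j+1})_b` AND `|B_b| < 2dLα₁`, odd `L`.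
[cite: Balaban1985RegularSpaces, (1.36)–(1.37) p.82, (1.35) p.82, (1.31) p.82, Theorem 2 p.83; Balaban1987RG1, (0.4) p.253] -/
theorem eq137_crossing {L s : ℕ} (hLs : L = 2 * s + 1) (hd : 1 ≤ d) (U₀ U₁ : Site d → Fin d → 𝔸ˣ) (u : Site d → 𝔸ˣ) (j : ℕ)
    (y : Site d) (κ : Fin d)
    (h87 : ∀ x : Site d, InBox ((L : ℤ) • y - halfVec L) ((L : ℤ) • y + halfVec L) x → uLev L u j x = (wrecZ L U₀ U₁ j x)⁻¹)
    (hp : uLev L u (j + 1) (y + e κ) = (wrecZ L U₀ U₁ (j + 1) (y + e κ))⁻¹)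
    (hU : ∀ x μ, avgIterZ L (mgauge U₀ u U₁ * U₀) j x μ ∈ U1 𝔸) (hV₀ : ∀ x μ, avgIterZ L U₀ j x μ ∈ U1 𝔸)
    (hW : avgIterZ L (mgauge U₀ u U₁ * U₀) (j + 1) y κ ∈ U1 𝔸) (hW₀ : avgIterZ L U₀ (j + 1) y κ ∈ U1 𝔸)
    {α₁ : ℝ} (hα : 0 < α₁) (hsmall : (d : ℝ) * L * α₁ ≤ 1 / 8)
    (h135 : ∀ (z : Site d) (μ : Fin d), (L : ℤ) • y - halfVec L ≤ z → z + e μ ≤ (L : ℤ) • y + halfVec L →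
      ‖(avgIterZ L (mgauge U₀ u U₁ * U₀) j z μ : 𝔸) - (avgIterZ L U₀ j z μ : 𝔸)‖ ≤ α₁)
    (h135b : ‖(avgIterZ L (mgauge U₀ u U₁ * U₀) (j + 1) y κ : 𝔸) - (avgIterZ L U₀ (j + 1) y κ : 𝔸)‖ ≤ α₁) :
    exp (I • BcrossZ L (avgIterZ L U₀ j) (tildIterZ L U₀ (mgauge U₀ u U₁) j) ((L : ℤ) • y)
        (tildIterZ L U₀ (mgauge U₀ u U₁) (j + 1) y κ))
        = ((dbavgCovIterZ L U₀ U₁ (j + 1) y κ : 𝔸ˣ) : 𝔸)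
      ∧ ‖BcrossZ L (avgIterZ L U₀ j) (tildIterZ L U₀ (mgauge U₀ u U₁) j) ((L : ℤ) • y)
          (tildIterZ L U₀ (mgauge U₀ u U₁) (j + 1) y κ)‖ < 2 * d * L * α₁ := by
  -- the bound and the smallness: `B8Thm2LogBRec` §3 verbatim
  have hbd := (B8Thm2LogBRec.ineq137_of_ineq135 L hLs hd hα hsmall (avgIterZ L (mgauge U₀ u U₁ * U₀) j) (avgIterZ L U₀ j)
    hU hV₀ ((L : ℤ) • y) h135 hW hW₀ h135b).2
  rw [pert_avgIterZ_eq_tildIterZ, ← tildIterZ_apply] at hbd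
  refine ⟨?_, hbd⟩
  -- `exp[−iΣ]Ũ′_b` lies inside the domain of `log`
  have hw1 : avgIterZ L (mgauge U₀ u U₁ * U₀) (j + 1) y κ * (avgIterZ L U₀ (j + 1) y κ)⁻¹ ∈ U1 𝔸 :=
    (U1 𝔸).mul_mem hW ((U1 𝔸).inv_mem hW₀)
  have hw : ‖((avgIterZ L (mgauge U₀ u U₁ * U₀) (j + 1) y κ * (avgIterZ L U₀ (j + 1) y κ)⁻¹ : 𝔸ˣ) : 𝔸) - 1‖ ≤ α₁ :=
    (B8Thm2LogB.norm_mul_inv_sub_one_le _ hW₀).trans h135b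
  have hs : B8Thm2LogB.BondSmall (pert (avgIterZ L (mgauge U₀ u U₁ * U₀) j) (avgIterZ L U₀ j)) ((L : ℤ) • y - halfVec L)
      ((L : ℤ) • y + halfVec L) α₁ := fun z μ hz hzμ =>
    (B8Thm2LogB.norm_pert_sub_one_le _ _ z μ (hV₀ z μ)).trans (h135 z μ hz hzμ)
  have hd' : (1 : ℝ) ≤ d := by exact_mod_cast hd
  have hLr : (L : ℝ) = 2 * s + 1 := by exact_mod_cast hLs
  have hs0 : (0 : ℝ) ≤ s := Nat.cast_nonneg _
  set n : ℝ := d * (s : ℝ) with hndef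
  have hn : 0 ≤ n := by rw [hndef]; positivity
  have hn1 : (n + 1) * α₁ ≤ (d : ℝ) * L * α₁ := by
    rw [hndef]
    have : (d : ℝ) * s + 1 ≤ d * L := by nlinarith
    nlinarith
  have hA := B8Thm2LogB.arith137 hn hα (hn1.trans hsmall)
  have hτ : n * α₁ < 1 := by nlinarith
  have hS := B8Thm2LogBRec.norm_crossSumZ_le L hLs (avgIterZ L U₀ j) _ hV₀ (B8Thm2LogB.pert_mem hU hV₀) ((L : ℤ) • y) hα.le hs
    (by rw [← hndef]; exact hτ)
  rw [← hndef] at hS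
  have hmid := B8Thm2LogBRec.norm_crossMidZ_sub_one_le L (avgIterZ L U₀ j) _ ((L : ℤ) • y) hS (mem_U1.mp hw1).1 hw
  have hlt : ‖crossMidZ L (avgIterZ L U₀ j) (pert (avgIterZ L (mgauge U₀ u U₁ * U₀) j) (avgIterZ L U₀ j)) ((L : ℤ) • y)
      (avgIterZ L (mgauge U₀ u U₁ * U₀) (j + 1) y κ * (avgIterZ L U₀ (j + 1) y κ)⁻¹) - 1‖ < 1 :=
    hmid.trans_lt hA.1
  -- the identification `exp iB_b = exp[−iΣ]Ũ′_b = (U̿₁)_b` (§5 at `V := (U′U₀)‾`, (1.13) tautological)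
  have hid := eq131_crossing hLs U₀ U₁ u j y κ (avgIterZ L (mgauge U₀ u U₁ * U₀) j)
    (avgIterZ L (mgauge U₀ u U₁ * U₀) (j + 1)) h87 (fun _ _ _ _ => rfl) hp rfl
  have hexp := exp_I_smul_BcrossZ L _ _ _ hlt
  rw [pert_avgIterZ_eq_tildIterZ] at hexp hid
  rw [← hid] at hexp
  rw [tildIterZ_apply]
  exact hexp

end Thm2Line

end Literature.MathematicalPhysics.QuantumFieldTheory.Balaban1983to89.B8Eq131DerivationRec

/-! ## Axiom audit (gate whitelist: `propext`, `Classical.choice`, `Quot.sound`) -/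
#print axioms Literature.MathematicalPhysics.QuantumFieldTheory.Balaban1983to89.B8Eq131DerivationRec.eq87_of_inAxZ_restr129Z
#print axioms Literature.MathematicalPhysics.QuantumFieldTheory.Balaban1983to89.B8Eq131DerivationRec.eq131_crossing
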